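import Mathlib

/-!
# FunctionalMining/NoGo — junction algebra of the sharp class, II: TILTED junction lines, the explicit
# 4-valent free junction, coplanarity (`SIEVELD.md` §3.4b (8f)); no-go seat, cell `pub-nsfunc`, gen 23

Search for candidate a priori estimates; no regularity claim. STAGED for the prove seat
(`pub-nsfunc-nogo/NoGo/STAGING.md`, filing request #5; companion of `FreeJunctionLoopLaw.lean`,
request #4 — the two files are `import Mathlib` only and do not import each other).

Context (informal, NOT formalised — the modelling dictionary; see the companion file). Wells
`K(n) = λ(|n|² I − 3 n⊗n)`; a junction line with unit tangent `τ` where `k ≥ 3` walls containing `τ`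
meet; all incident directors share the tilt `s = n·τ` (`common_tilt`), so `n = (c cos α, c sin α, s)`,
`c² + s² = 1` (the identities below are homogeneous and never use the normalisation); the planar `E2`
vertices are the case `s² = 1/3`, free junctions are `s = 0`. A wall containing `τ` at the ray angle `ν`
REFLECTS the in-plane angle, `α ↦ 2ν − α` (mod `2π` if `s ≠ 0`, mod `π` if `s = 0`); `δ := ν − α`.

What this file PROVES (finite-dimensional real algebra only; `[ours, elementary]`):

* `quadForm_directorMoment`, `directorMoment_degenerate_iff` (core of the coplanarity criterion
  (8f)(T1): for positive weights `vᵀ(Σ θ_i n_i⊗n_i)v = 0 ↔ v ⊥ n_i ∀ i`); `well3_quadForm`,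
  `well3_stretch_of_perp` (a free junction is a line of pure stretching — behind (8f)(E)); `common_tilt`.
* `jump3_decomp`, `trace_jump3`, `jump3_mulVec_tangent`, `jump3_mulVec_axis`, `K3_eq_well3`, `e3_reflect`:
  the Hadamard jump across the wall at `ν` is `(−6λc² sin 2δ · t(ν) − 12λcs sin δ · τ) ⊗ N(ν)`; symmetric
  part = strain jump `K(ν+δ) − K(ν−δ)`; antisymmetric part `3λc² sin 2δ · J₃ − 3λcs (L(ν+δ) − L(ν−δ))`
  with a TELESCOPING axial part; trace-free; kills both in-wall directions `t(ν)` and `τ`.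
* `loop_sum3`, `loop_law3` (closure mod `2π`, which by `K3_eq_K3_iff` IS single-valuedness of the strain
  on a tilted line): `∇u` is single-valued around the line iff `λ = 0 ∨ c = 0 ∨ Σ_{i<k} sin(2δ_i) = 0` —
  the vertex law of the eikonal calculus (7) (`Δ = 2δ`) at every tilt; `loop_law3_free` (`s = 0`, mod `π`).
* `no_threeValent_junction_closure_two_pi`: closure mod `2π` + loop law for three walls force
  `sin δ_i = 0` for some `i`: no 3-valent junction at any tilt (free case: companion file).
* `ex_*`: the explicit non-degenerate 4-valent FREE junction of (8f) (two planes through the line, 45°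
  apart; directors `0, −π/4, −π/2, π/4`; `δ = (−π/8, −π/8, 3π/8, 3π/8)`, closure mod `π`): reflection law,
  loop law, `Σ jumps = 0` for every `λ, c` (`ex_single_valued`), non-degeneracy, clockwise ray order.

Nothing here is a statement about Navier–Stokes (static sharp-interface model of the heat-flow
coercivity question `L-λ(λ₁)`, `TopEigHeatCoercivePos`, OPEN). Second implementation: pure-python
`pub-nsfunc-nogo/sieveld/junction/check_identities_num.py` (3×3 identities: max residual 5.7e-14 over
2·10⁴ samples; tilted loop sum 2.8e-13 over 2000 random chains; the 4-valent example exactly).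
-/

noncomputable section

namespace Summit.NavierStokesRegularity.FunctionalMining.SharpClass.TiltedJunction

open Real Matrix Finset

/-! ## 1. Coplanarity criterion (quadratic-form core of (8f)(T1)) and unit stretching along `τ` -/

/-- `vᵀ (n⊗n) v = (n·v)²`. -/
private theorem dot_vecMulVec_mulVec (n v : Fin 3 → ℝ) :
    v ⬝ᵥ (vecMulVec n n *ᵥ v) = (n ⬝ᵥ v) ^ 2 := by
  simp [vecMulVec, mulVec, dotProduct, Fin.sum_univ_three, Matrix.of_apply]; ring

/-- `vᵀ (Σ_i θ_i n_i⊗n_i) v = Σ_i θ_i (n_i·v)²`. -/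
theorem quadForm_directorMoment {ι : Type*} (s : Finset ι) (θ : ι → ℝ) (n : ι → Fin 3 → ℝ)
    (v : Fin 3 → ℝ) :
    v ⬝ᵥ ((∑ i ∈ s, θ i • vecMulVec (n i) (n i)) *ᵥ v) = ∑ i ∈ s, θ i * (n i ⬝ᵥ v) ^ 2 := by
  classical
  induction s using Finset.induction_on with
  | empty => simp
  | insert a s ha ih =>
    rw [sum_insert ha, sum_insert ha, add_mulVec, dotProduct_add, ih, smul_mulVec,
      dotProduct_smul, smul_eq_mul, dot_vecMulVec_mulVec]

/-- **Coplanarity criterion, algebraic core.** With positive weights, the director second-moment form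
vanishes at `v` iff `v ⊥ n_i` for every `i`: `λ_min(Σθ_i n_i⊗n_i) = 0` iff the directors are
coplanar (all in `v^⊥`), which by THEOREM T is exactly 'the junction line with tangent `v` is free'.
[ours, elementary] -/
theorem directorMoment_degenerate_iff {ι : Type*} (s : Finset ι) (θ : ι → ℝ)
    (hθ : ∀ i ∈ s, 0 < θ i) (n : ι → Fin 3 → ℝ) (v : Fin 3 → ℝ) :
    ∑ i ∈ s, θ i * (n i ⬝ᵥ v) ^ 2 = 0 ↔ ∀ i ∈ s, n i ⬝ᵥ v = 0 := by
  rw [sum_eq_zero_iff_of_nonneg (fun i hi => mul_nonneg (hθ i hi).le (sq_nonneg _))]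
  refine forall₂_congr fun i hi => ?_
  rw [mul_eq_zero, or_iff_right (hθ i hi).ne', sq_eq_zero_iff]

/-- The `3 × 3` well `K(n) = λ(|n|² I − 3 n⊗n)` (homogeneous form, as in `SharpClassProduction`). -/
def well3 (lam : ℝ) (n : Fin 3 → ℝ) : Matrix (Fin 3) (Fin 3) ℝ :=
  lam • ((n ⬝ᵥ n) • (1 : Matrix (Fin 3) (Fin 3) ℝ) - (3 : ℝ) • vecMulVec n n)

/-- `τᵀ K(n) τ = λ (|n|²|τ|² − 3 (n·τ)²)`. -/
theorem well3_quadForm (lam : ℝ) (n τ : Fin 3 → ℝ) :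
    τ ⬝ᵥ (well3 lam n *ᵥ τ) = lam * ((n ⬝ᵥ n) * (τ ⬝ᵥ τ) - 3 * (n ⬝ᵥ τ) ^ 2) := by
  simp [well3, mulVec, dotProduct, vecMulVec, Fin.sum_univ_three, Matrix.sub_apply,
    Matrix.smul_apply, Matrix.one_apply]; ring

/-- **A free junction is a line of pure stretching.** If the director is orthogonal to the junction
tangent (`n·τ = 0`, the free case `s_e = 0`) then `τᵀK(n)τ = λ|n|²|τ|²`: along the line `u·τ` grows at
the full rate `λ` in every incident cell, whence `|e| ≤ osc(u·τ)/λ ≤ 2‖u‖_∞/λ` ((8f)(E)). -/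
theorem well3_stretch_of_perp (lam : ℝ) (n τ : Fin 3 → ℝ) (h : n ⬝ᵥ τ = 0) :
    τ ⬝ᵥ (well3 lam n *ᵥ τ) = lam * ((n ⬝ᵥ n) * (τ ⬝ᵥ τ)) := by
  rw [well3_quadForm, h]; ring

/-- Common tilt across a wall containing `τ`: if the wall normal is `∥ n ∓ n'` and orthogonal to `τ`,
then `n·τ = ± n'·τ` — all directors around a junction line have the same `|n·τ| = s_e`. -/
theorem common_tilt (n n' τ : Fin 3 → ℝ) :
    ((n - n') ⬝ᵥ τ = 0 → n ⬝ᵥ τ = n' ⬝ᵥ τ) ∧ ((n + n') ⬝ᵥ τ = 0 → n ⬝ᵥ τ = -(n' ⬝ᵥ τ)) := by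
  constructor
  · intro h; rw [sub_dotProduct] at h; linarith
  · intro h; rw [add_dotProduct] at h; linarith

/-! ## 2. Tilted junction lines (common tilt `s`): the same scalar loop law

Around a general (charged) junction line all incident directors have the common tilt `s = n·τ`
(`common_tilt`); write `n = (c cos α, c sin α, s)` (`c² + s² = 1` for a unit director — the identities
below are homogeneous and need no normalisation). Walls containing `τ` again REFLECT the in-plane angle,
`α ↦ 2ν − α`, now mod `2π` when `s ≠ 0`. The Hadamard jump acquires an axial component:
`a = −6λc² sin(2δ) t(ν) − 12λcs sin(δ) τ`, and its antisymmetric part is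
`3λc² sin(2δ) J₃ − 3λcs (L(ν+δ) − L(ν−δ))` with `L(α) = τ⊗e(α) − e(α)⊗τ` — the axial part TELESCOPES, so
director closure leaves exactly the scalar law `Σ sin 2δ_i = 0` at every tilt with `c ≠ 0` ((8f): 'the same
vertex laws as the eikonal calculus (7) (Δ = 2δ)'; the planar `E2` vertices are the case `s² = 1/3`). -/

/-- In-plane unit vector at angle `α`, embedded in `ℝ³` (`τ = e₂`). -/
def e3 (α : ℝ) : Fin 3 → ℝ := ![cos α, sin α, 0]

/-- The junction tangent `τ`. -/
def τ3 : Fin 3 → ℝ := ![0, 0, 1]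

/-- Director with in-plane amplitude `c`, angle `α` and tilt `s`: `n = (c cos α, c sin α, s)`. -/
def dir3 (c s α : ℝ) : Fin 3 → ℝ := ![c * cos α, c * sin α, s]

/-- Unit tangent of the wall ray at angle `ν`, embedded in `ℝ³`. -/
def t3 (ν : ℝ) : Fin 3 → ℝ := ![cos ν, sin ν, 0]

/-- Unit normal of the wall ray at angle `ν` (the wall normal `N(ν)`), embedded in `ℝ³`. -/
def N3 (ν : ℝ) : Fin 3 → ℝ := ![-sin ν, cos ν, 0]

/-- Rotation generator about `τ`. -/
def J3 : Matrix (Fin 3) (Fin 3) ℝ := !![0, -1, 0; 1, 0, 0; 0, 0, 0]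

/-- `L(α) = τ ⊗ e(α) − e(α) ⊗ τ` (the axial antisymmetric generators). -/
def L3 (α : ℝ) : Matrix (Fin 3) (Fin 3) ℝ :=
  !![0, 0, -cos α; 0, 0, -sin α; cos α, sin α, 0]

/-- The tilted well `K = λ((c² + s²) I − 3 n⊗n)`, `n = dir3 c s α`, in double-angle form
(`K3_eq_well3`). -/
def K3 (lam c s α : ℝ) : Matrix (Fin 3) (Fin 3) ℝ :=
  !![lam * ((c ^ 2 + s ^ 2) - 3 * c ^ 2 / 2 * (1 + cos (2 * α))),
      lam * (-(3 * c ^ 2 / 2 * sin (2 * α))), lam * (-(3 * c * s * cos α));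
     lam * (-(3 * c ^ 2 / 2 * sin (2 * α))),
      lam * ((c ^ 2 + s ^ 2) - 3 * c ^ 2 / 2 * (1 - cos (2 * α))), lam * (-(3 * c * s * sin α));
     lam * (-(3 * c * s * cos α)), lam * (-(3 * c * s * sin α)), lam * (c ^ 2 - 2 * s ^ 2)]

/-- The Hadamard amplitude of the tilted wall jump. -/
def amp3 (lam c s ν δ : ℝ) : Fin 3 → ℝ :=
  (-(6 * lam * c ^ 2 * sin (2 * δ))) • t3 ν + (-(12 * lam * c * s * sin δ)) • τ3

/-- The tilted wall jump `a ⊗ N(ν)` across the wall ray `ν` with deviation `δ`. -/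
def jump3 (lam c s ν δ : ℝ) : Matrix (Fin 3) (Fin 3) ℝ := vecMulVec (amp3 lam c s ν δ) (N3 ν)

/-- `L3 α` is `τ ⊗ e(α) − e(α) ⊗ τ`. -/
theorem L3_eq (α : ℝ) : L3 α = vecMulVec τ3 (e3 α) - vecMulVec (e3 α) τ3 := by
  ext i j
  fin_cases i <;> fin_cases j <;> simp [L3, τ3, e3]

/-- The double-angle form `K3` IS the well `λ(|n|² I − 3 n⊗n)` at `n = dir3 c s α`. -/
theorem K3_eq_well3 (lam c s α : ℝ) : K3 lam c s α = well3 lam (dir3 c s α) := by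
  have hc : cos (2 * α) = 2 * cos α ^ 2 - 1 := cos_two_mul α
  have hs : sin (2 * α) = 2 * sin α * cos α := sin_two_mul α
  have hp : sin α ^ 2 + cos α ^ 2 = 1 := sin_sq_add_cos_sq α
  ext i j
  fin_cases i <;> fin_cases j <;>
    simp [K3, well3, dir3, dotProduct, Fin.sum_univ_three, Matrix.sub_apply, Matrix.smul_apply, hc, hs,
      -mul_eq_mul_left_iff, -mul_eq_mul_right_iff] <;>
    first | ring1 | (linear_combination (-(lam * c ^ 2)) * hp) | (linear_combination (lam * c ^ 2) * hp) | (linear_combination (2 * lam * c ^ 2) * hp)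

/-- In-plane director reflection: `e(ν+δ) − e(ν−δ) = 2 sin δ · N(ν)`. -/
theorem e3_reflect (ν δ : ℝ) : e3 (ν + δ) - e3 (ν - δ) = (2 * sin δ) • N3 ν := by
  ext i
  fin_cases i <;> simp [e3, N3, cos_add, cos_sub, sin_add, sin_sub] <;> ring

/-- **Tilted wall-jump decomposition.** Symmetric part = strain jump between the wells `K(ν∓δ)`;
antisymmetric part = `3λc² sin(2δ) J₃` (rotation about `τ`) plus the TELESCOPING axial part
`−3λcs (L(ν+δ) − L(ν−δ))`. [ours, elementary; SIEVELD §3.4b (8f)] -/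
theorem jump3_decomp (lam c s ν δ : ℝ) :
    jump3 lam c s ν δ = (K3 lam c s (ν + δ) - K3 lam c s (ν - δ))
      - (3 * lam * c * s) • (L3 (ν + δ) - L3 (ν - δ)) + (3 * lam * c ^ 2 * sin (2 * δ)) • J3 := by
  have hp : sin ν ^ 2 + cos ν ^ 2 = 1 := sin_sq_add_cos_sq ν
  ext i j
  fin_cases i <;> fin_cases j <;>
    simp [jump3, amp3, t3, τ3, N3, K3, L3, J3, vecMulVec_apply, cos_two_mul, sin_two_mul, cos_add,
      cos_sub, sin_add, sin_sub] <;>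
    first | ring1 | (linear_combination (-(6 * lam * c ^ 2 * sin δ * cos δ)) * hp) | (linear_combination (6 * lam * c ^ 2 * sin δ * cos δ) * hp)

/-- The tilted jump is trace-free (compatible with `div u = 0` on both sides). -/
theorem trace_jump3 (lam c s ν δ : ℝ) : trace (jump3 lam c s ν δ) = 0 := by
  simp [jump3, amp3, t3, τ3, N3, trace, Fin.sum_univ_three]; ring

/-- The tilted jump kills the wall tangent `t(ν)` (continuity of `u` along the wall). -/
theorem jump3_mulVec_tangent (lam c s ν δ : ℝ) : jump3 lam c s ν δ *ᵥ t3 ν = 0 := by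
  ext i
  fin_cases i <;> simp [jump3, amp3, t3, τ3, N3, mulVec, dotProduct, vecMulVec_apply,
    Fin.sum_univ_three] <;> ring

/-- The tilted jump kills the junction tangent `τ` (continuity of `u` along the line). -/
theorem jump3_mulVec_axis (lam c s ν δ : ℝ) : jump3 lam c s ν δ *ᵥ τ3 = 0 := by
  ext i
  fin_cases i <;> simp [jump3, amp3, t3, τ3, N3, mulVec, dotProduct, vecMulVec_apply,
    Fin.sum_univ_three]

/-- Director closure for tilted wells: `K` and `L` only see `α` mod `2π`. -/
theorem K3_add_int_mul_two_pi (lam c s α : ℝ) (m : ℤ) :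
    K3 lam c s (α + m * (2 * π)) = K3 lam c s α := by
  have h : 2 * (α + m * (2 * π)) = 2 * α + (2 * m : ℤ) * (2 * π) := by push_cast; ring
  simp only [K3, h, cos_add_int_mul_two_pi, sin_add_int_mul_two_pi]

/-- `L` only sees `α` mod `2π`. -/
theorem L3_add_int_mul_two_pi (α : ℝ) (m : ℤ) : L3 (α + m * (2 * π)) = L3 α := by
  simp only [L3, cos_add_int_mul_two_pi, sin_add_int_mul_two_pi]

/-- Conversely, on a tilted line (`λ, c, s ≠ 0`) the strain determines the director angle mod `2π`:
`K(α) = K(β) ↔ (cos α, sin α) = (cos β, sin β)` — strain single-valuedness IS closure mod `2π`. -/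
theorem K3_eq_K3_iff (lam c s α β : ℝ) (hlam : lam ≠ 0) (hc : c ≠ 0) (hs : s ≠ 0) :
    K3 lam c s α = K3 lam c s β ↔ (cos α = cos β ∧ sin α = sin β) := by
  constructor
  · intro h
    have h02 := congr_fun (congr_fun h 0) 2
    have h12 := congr_fun (congr_fun h 1) 2
    simp [K3, hlam, hc, hs] at h02 h12
    exact ⟨h02, h12⟩
  · rintro ⟨hcos, hsin⟩
    simp only [K3, cos_two_mul, sin_two_mul, hcos, hsin]

/-- **Tilted loop sum.** Walls `i < k`, wall `i` at `α i + δ i` taking `α i` to `α (i+1) = α i + 2 δ i`: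
both the strain part and the axial antisymmetric part telescope; only `3λc² (Σ sin 2δ_i) J₃` accumulates. -/
theorem loop_sum3 (lam c s : ℝ) (α δ : ℕ → ℝ) (k : ℕ)
    (hrefl : ∀ i, i < k → α (i + 1) = α i + 2 * δ i) :
    ∑ i ∈ range k, jump3 lam c s (α i + δ i) (δ i) =
      (K3 lam c s (α k) - K3 lam c s (α 0)) - (3 * lam * c * s) • (L3 (α k) - L3 (α 0))
        + (3 * lam * c ^ 2 * ∑ i ∈ range k, sin (2 * δ i)) • J3 := by
  induction k with
  | zero => simp
  | succ k ih =>
    have ih' := ih (fun i hi => hrefl i (Nat.lt_succ_of_lt hi))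
    have hk : α (k + 1) = α k + 2 * δ k := hrefl k (Nat.lt_succ_self k)
    rw [sum_range_succ, sum_range_succ, ih', jump3_decomp]
    have e1 : α k + δ k + δ k = α (k + 1) := by rw [hk]; ring
    have e2 : α k + δ k - δ k = α k := by ring
    rw [e1, e2, mul_add, add_smul, smul_sub, smul_sub, smul_sub]
    abel

/-- **The loop law at every tilt (SIEVELD §3.4b (8f), eikonal vertex law (7)).** With director closure
mod `2π` (`α k = α 0 + 2πm`), `∇u` is single-valued around the junction line iff
`λ = 0 ∨ c = 0 ∨ Σ_{i<k} sin(2δ_i) = 0`. -/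
theorem loop_law3 (lam c s : ℝ) (α δ : ℕ → ℝ) (k : ℕ) (m : ℤ)
    (hrefl : ∀ i, i < k → α (i + 1) = α i + 2 * δ i) (hclos : α k = α 0 + m * (2 * π)) :
    ∑ i ∈ range k, jump3 lam c s (α i + δ i) (δ i) = 0 ↔
      lam = 0 ∨ c = 0 ∨ ∑ i ∈ range k, sin (2 * δ i) = 0 := by
  rw [loop_sum3 lam c s α δ k hrefl, hclos, K3_add_int_mul_two_pi, L3_add_int_mul_two_pi, sub_self,
    sub_self, smul_zero, sub_zero, zero_add]
  constructor
  · intro h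
    have h10 := congr_fun (congr_fun h 1) 0
    simp [J3, Matrix.smul_apply] at h10
    rcases h10 with (h | h) | h
    · exact Or.inl h
    · exact Or.inr (Or.inl h)
    · exact Or.inr (Or.inr h)
  · rintro (h | h | h) <;> simp [h]

/-- The free case inside the tilted algebra: for `s = 0` the axial part is absent and closure mod `π`
suffices (`K3 lam c 0` only sees `α` mod `π`). -/
theorem K3_free_add_int_mul_pi (lam c α : ℝ) (m : ℤ) : K3 lam c 0 (α + m * π) = K3 lam c 0 α := by
  have h : 2 * (α + m * π) = 2 * α + m * (2 * π) := by ring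
  simp only [K3, h, cos_add_int_mul_two_pi, sin_add_int_mul_two_pi]
  ext i j
  fin_cases i <;> fin_cases j <;> simp

/-- Free loop law in `3×3` form: for `s = 0` and closure mod `π` the jumps sum to `3λc² (Σ sin 2δ_i) J₃`. -/
theorem loop_law3_free (lam c : ℝ) (α δ : ℕ → ℝ) (k : ℕ) (m : ℤ)
    (hrefl : ∀ i, i < k → α (i + 1) = α i + 2 * δ i) (hclos : α k = α 0 + m * π) :
    ∑ i ∈ range k, jump3 lam c 0 (α i + δ i) (δ i) =
      (3 * lam * c ^ 2 * ∑ i ∈ range k, sin (2 * δ i)) • J3 := by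
  rw [loop_sum3 lam c 0 α δ k hrefl, hclos, K3_free_add_int_mul_pi, sub_self]
  simp

/-! ## 3. No 3-valent junction at any tilt (SIEVELD §3.4b (8a)(iv) THEOREM; eikonal (R5))

Pen statement booked as (8a)(iv) 'THEOREM (no 3-valent junction lines, any tilt)' and, for the planar
class, (7) (R5) / THEOREM S (vi) — kernel form `E2.TheoremSCore.no_three_valent_vertex` (jumps summing
to `0`). The factorisation is `E2.TheoremSCore.sin_two_mul_add_sin_two_mul_sub`, restated to stay
`import Mathlib`-only; new here is the closure-mod-`2π` form with arbitrary winding `m`. -/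

/-- `sin 2a + sin 2b − sin(2a + 2b) = 4 sin a · sin b · sin(a + b)`
(= `E2.TheoremSCore.sin_two_mul_add_sin_two_mul_sub`; also in the companion file). -/
theorem sin_add_sin_sub_sin_add (a b : ℝ) :
    sin (2 * a) + sin (2 * b) - sin (2 * a + 2 * b) = 4 * sin a * sin b * sin (a + b) := by
  have e : 2 * a + 2 * b = 2 * (a + b) := by ring
  rw [e, sin_two_mul, sin_two_mul, sin_two_mul, sin_add, cos_add]
  have ha := sin_sq_add_cos_sq a
  have hb := sin_sq_add_cos_sq b
  linear_combination (-(2 * sin a * cos a)) * hb + (-(2 * sin b * cos b)) * ha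

/-- **No non-degenerate 3-valent junction at any tilt.** With closure mod `2π`
(`δ₀ + δ₁ + δ₂ = m π`, i.e. `Σ 2δ_i = 2πm`) the loop law forces `sin δ_i = 0` for some `i`: across that
wall the in-plane angle does not move mod `2π` — it is not a wall. (For `s = 0` closure mod `π` is
allowed and `no_threeValent_free_junction` of the companion file applies instead.) -/
theorem no_threeValent_junction_closure_two_pi (δ₀ δ₁ δ₂ : ℝ) (m : ℤ)
    (hclos : δ₀ + δ₁ + δ₂ = m * π)
    (hloop : sin (2 * δ₀) + sin (2 * δ₁) + sin (2 * δ₂) = 0) :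
    sin δ₀ = 0 ∨ sin δ₁ = 0 ∨ sin δ₂ = 0 := by
  have h2 : 2 * δ₂ = -(2 * δ₀ + 2 * δ₁) + (2 * m : ℤ) * π := by push_cast; linarith
  have hs2 : sin (2 * δ₂) = -sin (2 * δ₀ + 2 * δ₁) := by
    rw [h2, sin_add_int_mul_pi, sin_neg]
    have : Even (2 * m) := even_two_mul m
    rw [this.neg_one_zpow]; ring
  have hd2 : δ₂ = -(δ₀ + δ₁) + m * π := by linarith
  have hs2' : sin δ₂ = -((-1 : ℝ) ^ m * sin (δ₀ + δ₁)) := by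
    rw [hd2, sin_add_int_mul_pi, sin_neg]; ring
  rw [hs2, ← sub_eq_add_neg, sin_add_sin_sub_sin_add] at hloop
  rcases mul_eq_zero.mp hloop with h | h
  · rcases mul_eq_zero.mp h with h | h
    · rcases mul_eq_zero.mp h with h | h
      · norm_num at h
      · exact Or.inl h
    · exact Or.inr (Or.inl h)
  · right; right; rw [hs2', h]; ring

/-! ## 4. An explicit non-degenerate 4-valent FREE junction (`s = 0`, closure mod `π`; (8f)) -/

/-- Deviations of the four walls: `δ = (−π/8, −π/8, 3π/8, 3π/8)`. -/
def exδ : ℕ → ℝ := fun i => if i < 2 then -(π / 8) else 3 * π / 8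

/-- Directors in the four sectors: `α = (0, −π/4, −π/2, π/4, [π ≡ 0])`, `α (i+1) = α i + 2 δ i`. -/
def exα : ℕ → ℝ := fun i => ∑ j ∈ range i, 2 * exδ j

/-- Wall rays: `ν_i = α i + δ i (mod π)`; the rays actually used are `−π/8, −3π/8, 7π/8, 5π/8` (two
planes through the junction line, 45° apart, each contributing two opposite rays). -/
def exRay : Fin 4 → ℝ := ![-(π / 8), -(3 * π / 8), 7 * π / 8, 5 * π / 8]

/-- The reflection recursion `α (i+1) = α i + 2 δ i`. -/
theorem exα_succ (i : ℕ) : exα (i + 1) = exα i + 2 * exδ i := by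
  simp [exα, sum_range_succ]

/-- The four directors `α = (0, −π/4, −π/2, π/4)`. -/
theorem exα_values : exα 0 = 0 ∧ exα 1 = -(π / 4) ∧ exα 2 = -(π / 2) ∧ exα 3 = π / 4 := by
  refine ⟨?_, ?_, ?_, ?_⟩ <;> simp [exα, exδ, sum_range_succ] <;> ring

/-- Director closure: after the fourth wall the director is back to `0 (mod π)`. -/
theorem exα_four : exα 4 = exα 0 + (1 : ℤ) * π := by
  simp [exα, exδ, sum_range_succ]; ring

/-- The rays are the walls `α i + δ i` up to the `π`-ambiguity of a ray's line. -/
theorem exRay_eq : exRay 0 = exα 0 + exδ 0 ∧ exRay 1 = exα 1 + exδ 1 ∧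
    exRay 2 = exα 2 + exδ 2 + π ∧ exRay 3 = exα 3 + exδ 3 := by
  refine ⟨?_, ?_, ?_, ?_⟩ <;>
    simp [exRay, exα_values.1, exα_values.2.1, exα_values.2.2.1, exα_values.2.2.2, exδ] <;> ring

/-- Reflection law across each ray: director after = `2·ray − director before (mod π)`. -/
theorem ex_reflection :
    exα 1 = 2 * exRay 0 - exα 0 ∧ exα 2 = 2 * exRay 1 - exα 1 ∧
    exα 3 = 2 * exRay 2 - exα 2 + (-2 : ℤ) * π ∧ exα 4 = 2 * exRay 3 - exα 3 := by
  refine ⟨?_, ?_, ?_, ?_⟩ <;>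
    simp [exRay, exα, exδ, sum_range_succ] <;> ring

/-- The four values `sin 2δ_i = (−sin(π/4), −sin(π/4), sin(π/4), sin(π/4))`. -/
theorem ex_sin_two_mul_δ (i : ℕ) :
    sin (2 * exδ i) = if i < 2 then -sin (π / 4) else sin (π / 4) := by
  unfold exδ
  split_ifs with hi
  · rw [show 2 * -(π / 8) = -(π / 4) by ring, sin_neg]
  · rw [show 2 * (3 * π / 8) = π - π / 4 by ring, sin_pi_sub]

/-- Loop law: `Σ sin 2δ_i = −2 sin(π/4) + 2 sin(π/4) = 0`. -/
theorem ex_loop : ∑ i ∈ range 4, sin (2 * exδ i) = 0 := by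
  have h : ∑ i ∈ range 4, sin (2 * exδ i) =
      sin (2 * exδ 0) + sin (2 * exδ 1) + sin (2 * exδ 2) + sin (2 * exδ 3) := by
    simp [sum_range_succ]
  rw [h, ex_sin_two_mul_δ 0, ex_sin_two_mul_δ 1, ex_sin_two_mul_δ 2, ex_sin_two_mul_δ 3]
  norm_num

/-- Hence the jumps of `∇u` around the line sum to zero: the configuration is an exact (single-valued)
free junction, for every amplitude `λ` and in-plane size `c` (`jump3` with tilt `s = 0`). -/
theorem ex_single_valued (lam c : ℝ) :
    ∑ i ∈ range 4, jump3 lam c 0 (exα i + exδ i) (exδ i) = 0 := by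
  rw [loop_law3_free lam c exα exδ 4 1 (fun i _ => exα_succ i) exα_four, ex_loop, mul_zero, zero_smul]

/-- Non-degeneracy: every wall really changes the director (`sin 2δ_i = ∓ sin(π/4) ≠ 0`). -/
theorem ex_nondegenerate (i : ℕ) : sin (2 * exδ i) ≠ 0 := by
  have hq : sin (π / 4) ≠ 0 := by rw [sin_pi_div_four]; positivity
  rw [ex_sin_two_mul_δ]
  split_ifs
  · exact neg_ne_zero.mpr hq
  · exact hq

/-- Geometric realisability: the four rays are met in strictly CLOCKWISE order
`−π/8 > −3π/8 > 7π/8 − 2π > 5π/8 − 2π > −π/8 − 2π`, so the four sectors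
(widths `π/4, 3π/4, π/4, 3π/4`) tile the full turn around the junction line. -/
theorem ex_clockwise :
    exRay 1 < exRay 0 ∧ exRay 2 - 2 * π < exRay 1 ∧ exRay 3 - 2 * π < exRay 2 - 2 * π ∧
      exRay 0 - 2 * π < exRay 3 - 2 * π ∧
      (exRay 0 - exRay 1) + (exRay 1 - (exRay 2 - 2 * π)) + (exRay 2 - exRay 3) +
        (exRay 3 - 2 * π - (exRay 0 - 2 * π)) = 2 * π := by
  refine ⟨?_, ?_, ?_, ?_, ?_⟩ <;> simp [exRay] <;> nlinarith [pi_pos]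


end Summit.NavierStokesRegularity.FunctionalMining.SharpClass.TiltedJunction
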